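import Mathlib
import Literature.Geometry.DiscreteGeometry.KissingPatterns

/-!
# Crux `DisclinationRation.FiveFoldRation` (stmt-AtomisticToContinuum-15799), line `Sketch` —
# stub `stub_dr5_chains`: Chains of poles (abstract two-sided recursion)

The pole lemma (stub `stub_dr5_poleLemma`'s conclusion, as hypothesis BY STATEMENT) implies the
column family of the birth skeleton: `∃ Γ : Set (ℤ → ℝ³)` with (c1) every axis site on a chain,
(c2) chains inside the axis set, (c3) pole-to-pole decahedral matchings along chains.

Proof layout: `dr5ch_twoSided` (two-sided dependent choice on a subtype of good states),
`dr5ch_columns` (the abstract column lemma on states `(site, rotation, north-pole site,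
south-pole site)`), and the registered stub, which instantiates the abstract lemma with the
inline predicates and discharges the pole hypotheses by the pole lemma and
`-(0,0,1) = (0,0,-1)`.

All shell predicates are the route decl's inline `GA` / `GF` / `d` / `T` / `Deca`, copied verbatim
(registered signature: `Cruxes/FiveFoldRation/Lines/Sketch.lean`).
-/

noncomputable section

namespace Summit.AtomisticToContinuum.Crystallization.Theorems

/-! ## Abstract two-sided recursion -/

/-- Two-sided dependent choice: if every good state has a good successor and a good
predecessor, then through every good state passes a bi-infinite chain of good states,
consecutive ones related by `R`. -/
theorem dr5ch_twoSided {α : Type*} {Good : α → Prop} {R : α → α → Prop}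
    (hN : ∀ s, Good s → ∃ s', Good s' ∧ R s s')
    (hS : ∀ s, Good s → ∃ s', Good s' ∧ R s' s)
    {s₀ : α} (h₀ : Good s₀) :
    ∃ f : ℤ → α, f 0 = s₀ ∧ (∀ n, Good (f n)) ∧ ∀ n, R (f n) (f (n + 1)) := by
  have hN' : ∀ s : {s // Good s}, ∃ s' : {s // Good s}, R s.1 s'.1 := fun s =>
    let ⟨s', h1, h2⟩ := hN s.1 s.2; ⟨⟨s', h1⟩, h2⟩
  have hS' : ∀ s : {s // Good s}, ∃ s' : {s // Good s}, R s'.1 s.1 := fun s =>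
    let ⟨s', h1, h2⟩ := hS s.1 s.2; ⟨⟨s', h1⟩, h2⟩
  choose nx hnx using hN'
  choose pv hpv using hS'
  refine ⟨fun n => match n with
    | Int.ofNat k => (nx^[k] ⟨s₀, h₀⟩).1
    | Int.negSucc k => (pv^[k + 1] ⟨s₀, h₀⟩).1, rfl, ?_, ?_⟩
  · rintro (k | k)
    · exact (nx^[k] ⟨s₀, h₀⟩).2
    · exact (pv^[k + 1] ⟨s₀, h₀⟩).2
  · rintro (k | k)
    · show R (nx^[k] ⟨s₀, h₀⟩).1 (nx^[k + 1] ⟨s₀, h₀⟩).1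
      rw [Function.iterate_succ_apply']
      exact hnx _
    · cases k with
      | zero =>
        show R (pv^[1] ⟨s₀, h₀⟩).1 s₀
        exact hpv _
      | succ j =>
        show R (pv^[j + 2] ⟨s₀, h₀⟩).1 (pv^[j + 1] ⟨s₀, h₀⟩).1
        rw [Function.iterate_succ_apply' pv (j + 1)]
        exact hpv _

/-- **Abstract column lemma.** Sites `E`, rotations `Rot`, pattern `P` with two poles
`pN pS : P`, shells `T y ⊆ S`, matchings `e : T y ≃ P` with a tolerance predicate `tol`,
pole tolerances `Qn`/`Qs` read off from `tol` at the two pole sites, and the POLE property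
(the pole site of a matching is an axis site and carries a matching in which the centre is the
opposite pole): then the axis sites (`y ∈ S`, `¬ GF y`, each carrying a matching by `init`) are
covered by bi-infinite pole-to-pole chains. Pure logic (two-sided dependent choice on the states
`(site, rotation, north-pole site, south-pole site)`). -/
theorem dr5ch_columns {E Rot P : Type*} {S : Set E} {GF : E → Prop} {T : E → Set E}
    {tol : (y : E) → Rot → (↥(T y) ≃ P) → Prop} {pN pS : P} {Qn Qs : E → Rot → E → Prop}
    (hT : ∀ y, ∀ t : ↥(T y), (t : E) ∈ S)
    (hQn : ∀ y A (e : ↥(T y) ≃ P), tol y A e → Qn y A (e.symm pN : E))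
    (hQs : ∀ y A (e : ↥(T y) ≃ P), tol y A e → Qs y A (e.symm pS : E))
    (poleN : ∀ y ∈ S, ∀ A (e : ↥(T y) ≃ P), tol y A e → ∀ p : ↥(T y), e p = pN →
      ¬ GF p ∧ ∃ A', ∃ e' : ↥(T p) ≃ P, tol p A' e' ∧ ∃ hy : y ∈ T p, e' ⟨y, hy⟩ = pS)
    (poleS : ∀ y ∈ S, ∀ A (e : ↥(T y) ≃ P), tol y A e → ∀ p : ↥(T y), e p = pS →
      ¬ GF p ∧ ∃ A', ∃ e' : ↥(T p) ≃ P, tol p A' e' ∧ ∃ hy : y ∈ T p, e' ⟨y, hy⟩ = pN)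
    (init : ∀ y ∈ S, ¬ GF y → ∃ A e, tol y A e) :
    ∃ Γ : Set (ℤ → E), (∀ y ∈ S, ¬ GF y → ∃ γ ∈ Γ, ∃ n : ℤ, γ n = y) ∧
      (∀ γ ∈ Γ, ∀ n : ℤ, γ n ∈ S ∧ ¬ GF (γ n)) ∧
      (∀ γ ∈ Γ, ∀ n : ℤ, ∃ A, (∃ e : ↥(T (γ n)) ≃ P, tol (γ n) A e) ∧
        Qn (γ n) A (γ (n + 1)) ∧ Qs (γ n) A (γ (n - 1))) := by
  -- states: (site, rotation, north-pole site, south-pole site)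
  let Good : E × Rot × E × E → Prop := fun s => s.1 ∈ S ∧ ¬ GF s.1 ∧
    ∃ e : ↥(T s.1) ≃ P, tol s.1 s.2.1 e ∧ ((e.symm pN : ↥(T s.1)) : E) = s.2.2.1 ∧
      ((e.symm pS : ↥(T s.1)) : E) = s.2.2.2
  let R : E × Rot × E × E → E × Rot × E × E → Prop := fun s s' =>
    s'.1 = s.2.2.1 ∧ s.1 = s'.2.2.2
  have hNstep : ∀ s, Good s → ∃ s', Good s' ∧ R s s' := by
    rintro ⟨q, A, pn, ps⟩ ⟨hq, -, e, he, hn, -⟩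
    obtain ⟨hng', A', e', he', hy, hy'⟩ := poleN q hq A e he (e.symm pN) (e.apply_symm_apply pN)
    refine ⟨(((e.symm pN : ↥(T q)) : E), A', ((e'.symm pN : ↥(T _)) : E), q),
      ⟨hT _ _, hng', e', he', rfl, ?_⟩, hn, rfl⟩
    rw [← hy', Equiv.symm_apply_apply]
  have hSstep : ∀ s, Good s → ∃ s', Good s' ∧ R s' s := by
    rintro ⟨q, A, pn, ps⟩ ⟨hq, -, e, he, -, hs⟩
    obtain ⟨hng', A', e', he', hy, hy'⟩ := poleS q hq A e he (e.symm pS) (e.apply_symm_apply pS)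
    refine ⟨(((e.symm pS : ↥(T q)) : E), A', q, ((e'.symm pS : ↥(T _)) : E)),
      ⟨hT _ _, hng', e', he', ?_, rfl⟩, rfl, hs⟩
    rw [← hy', Equiv.symm_apply_apply]
  refine ⟨{γ | ∃ f : ℤ → E × Rot × E × E, (∀ n, Good (f n)) ∧ (∀ n, R (f n) (f (n + 1))) ∧
    γ = fun n => (f n).1}, ?_, ?_, ?_⟩
  · intro y hy hng
    obtain ⟨A, e, he⟩ := init y hy hng
    obtain ⟨f, hf0, hG, hR⟩ := dr5ch_twoSided hNstep hSstep
      (s₀ := (y, A, ((e.symm pN : ↥(T y)) : E), ((e.symm pS : ↥(T y)) : E)))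
      ⟨hy, hng, e, he, rfl, rfl⟩
    exact ⟨fun n => (f n).1, ⟨f, hG, hR, rfl⟩, 0, by simp only [hf0]⟩
  · rintro γ ⟨f, hG, hR, rfl⟩ n
    exact ⟨(hG n).1, (hG n).2.1⟩
  · rintro γ ⟨f, hG, hR, rfl⟩ n
    obtain ⟨-, -, e, he, hn, hs⟩ := hG n
    refine ⟨(f n).2.1, ⟨e, he⟩, ?_, ?_⟩
    · show Qn (f n).1 (f n).2.1 (f (n + 1)).1
      rw [(hR n).1, ← hn]
      exact hQn _ _ e he
    · have h2 := hR (n - 1)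
      rw [sub_add_cancel] at h2
      show Qs (f n).1 (f n).2.1 (f (n - 1)).1
      rw [h2.2, ← hs]
      exact hQs _ _ e he

/-! ## The concrete instance -/

/-- `-(0,0,1) = (0,0,-1)` in `ℝ³`. -/
theorem dr5ch_neg_north :
    -(!₂[(0 : ℝ), 0, 1] : EuclideanSpace ℝ (Fin 3)) = !₂[(0 : ℝ), 0, -1] := by
  rw [← WithLp.toLp_neg]
  congr 1
  funext i
  fin_cases i <;> simp

/-- `-(0,0,-1) = (0,0,1)` in `ℝ³`. -/
theorem dr5ch_neg_south :
    -(!₂[(0 : ℝ), 0, -1] : EuclideanSpace ℝ (Fin 3)) = !₂[(0 : ℝ), 0, 1] := by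
  rw [← WithLp.toLp_neg]
  congr 1
  funext i
  fin_cases i <;> simp

/-- **Chains of poles, verbatim form.** The pole lemma (stub `stub_dr5_poleLemma`'s conclusion, as
hypothesis BY STATEMENT) implies the column family of the birth skeleton: `∃ Γ : Set (ℤ → ℝ³)` with
(c1) every axis site on a chain, (c2) chains inside the axis set, (c3) pole-to-pole decahedral
matchings along chains. This is the statement of the line skeleton `Lines/Sketch.lean`, character for
character; `stub_dr5_chains` below is the same proposition with the inline predicates abbreviated by
`let`s (definitionally equal, see its one-line proof). -/
theorem stub_dr5_chains_verbatim : (∀ δ : ℝ, 0 < δ → ∀ S : Set (EuclideanSpace ℝ (Fin 3)), (∀ y ∈ S, ∀ z ∈ S, y ≠ z → δ ≤ dist y z) → (∃ R₁ : ℝ, ∀ p : EuclideanSpace ℝ (Fin 3), ∃ y ∈ S, dist y p ≤ R₁) → (∀ y ∈ S, (let d : ℝ := sInf ((fun z => dist z y) '' (S \ {y})); let T : Set (EuclideanSpace ℝ (Fin 3)) := {z : EuclideanSpace ℝ (Fin 3) | z ∈ S ∧ z ≠ y ∧ dist z y < 13 / 10 * d}; ∃ A : EuclideanSpace ℝ (Fin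 3) →ₗᵢ[ℝ] EuclideanSpace ℝ (Fin 3), (∃ e : ↥T ≃ ↥Literature.Geometry.DiscreteGeometry.fccKissingPattern, ∀ t : ↥T, dist (d⁻¹ • ((t : EuclideanSpace ℝ (Fin 3)) - y)) (A ((e t : ↥Literature.Geometry.DiscreteGeometry.fccKissingPattern) : EuclideanSpace ℝ (Fin 3))) ≤ 1 / 20) ∨ (∃ e : ↥T ≃ ↥Literature.Geometry.DiscreteGeometry.hcpKissingPattern, ∀ t : ↥T, dist (d⁻¹ • ((t : EuclideanSpace ℝ (Fin 3)) - y)) (A ((e t : ↥Literature.Geometry.DiscreteGeometry.hcpKissingPattern) : EuclideanSpace ℝ (Fin 3))) ≤ 1 / 20) ∨ (∃ e : ↥T ≃ ↥{p : EuclideanSpace ℝ (Fin 3) | p = !₂[(0 : ℝ), 0, 1] ∨ p = !₂[(0 : ℝ), 0, -1] ∨ ∃ k : Fin 5, ∃ σ : ℝ, (σ = 1 / 2 ∨ σ = -(1 / 2)) ∧ p = !₂[Real.sqrt 3 / 2 * Real.cos (2 * Real.pi * (k : ℝ) / 5), Real.sqrt 3 / 2 * Real.sin (2 * Real.pi * (k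 : ℝ) / 5), σ]}, ∀ t : ↥T, dist (d⁻¹ • ((t : EuclideanSpace ℝ (Fin 3)) - y)) (A ((e t : ↥{p : EuclideanSpace ℝ (Fin 3) | p = !₂[(0 : ℝ), 0, 1] ∨ p = !₂[(0 : ℝ), 0, -1] ∨ ∃ k : Fin 5, ∃ σ : ℝ, (σ = 1 / 2 ∨ σ = -(1 / 2)) ∧ p = !₂[Real.sqrt 3 / 2 * Real.cos (2 * Real.pi * (k : ℝ) / 5), Real.sqrt 3 / 2 * Real.sin (2 * Real.pi * (k : ℝ) / 5), σ]}) : EuclideanSpace ℝ (Fin 3))) ≤ 1 / 20))) → ∀ y ∈ S, ∀ A : EuclideanSpace ℝ (Fin 3) →ₗᵢ[ℝ] EuclideanSpace ℝ (Fin 3), ∀ e : ↥{z : EuclideanSpace ℝ (Fin 3) | z ∈ S ∧ z ≠ y ∧ dist z y < 13 / 10 * sInf ((fun z => dist z y) '' (S \ {y}))} ≃ ↥{p : EuclideanSpace ℝ (Fin 3) | p = !₂[(0 : ℝ), 0, 1] ∨ p = !₂[(0 : ℝ), 0, -1] ∨ ∃ k : Fin 5, ∃ σ : ℝ, (σ =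 1 / 2 ∨ σ = -(1 / 2)) ∧ p = !₂[Real.sqrt 3 / 2 * Real.cos (2 * Real.pi * (k : ℝ) / 5), Real.sqrt 3 / 2 * Real.sin (2 * Real.pi * (k : ℝ) / 5), σ]}, (∀ t : ↥{z : EuclideanSpace ℝ (Fin 3) | z ∈ S ∧ z ≠ y ∧ dist z y < 13 / 10 * sInf ((fun z => dist z y) '' (S \ {y}))}, dist ((sInf ((fun z => dist z y) '' (S \ {y})))⁻¹ • ((t : EuclideanSpace ℝ (Fin 3)) - y)) (A ((e t : ↥{p : EuclideanSpace ℝ (Fin 3) | p = !₂[(0 : ℝ), 0, 1] ∨ p = !₂[(0 : ℝ), 0, -1] ∨ ∃ k : Fin 5, ∃ σ : ℝ, (σ = 1 / 2 ∨ σ = -(1 / 2)) ∧ p = !₂[Real.sqrt 3 / 2 * Real.cos (2 * Real.pi * (k : ℝ) / 5), Real.sqrt 3 / 2 * Real.sin (2 * Real.pi * (k : ℝ) / 5), σ]}) : EuclideanSpace ℝ (Fin 3))) ≤ 1 / 20) → ∀ p : ↥{z : EuclideanSpace ℝ (Fin 3) | z ∈ S ∧ z ≠ y ∧ dist z y < 13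 / 10 * sInf ((fun z => dist z y) '' (S \ {y}))}, (((e p : ↥{p : EuclideanSpace ℝ (Fin 3) | p = !₂[(0 : ℝ), 0, 1] ∨ p = !₂[(0 : ℝ), 0, -1] ∨ ∃ k : Fin 5, ∃ σ : ℝ, (σ = 1 / 2 ∨ σ = -(1 / 2)) ∧ p = !₂[Real.sqrt 3 / 2 * Real.cos (2 * Real.pi * (k : ℝ) / 5), Real.sqrt 3 / 2 * Real.sin (2 * Real.pi * (k : ℝ) / 5), σ]}) : EuclideanSpace ℝ (Fin 3)) = !₂[(0 : ℝ), 0, 1] ∨ ((e p : ↥{p : EuclideanSpace ℝ (Fin 3) | p = !₂[(0 : ℝ), 0, 1] ∨ p = !₂[(0 : ℝ), 0, -1] ∨ ∃ k : Fin 5, ∃ σ : ℝ, (σ = 1 / 2 ∨ σ = -(1 / 2)) ∧ p = !₂[Real.sqrt 3 / 2 * Real.cos (2 * Real.pi * (k : ℝ) / 5), Real.sqrt 3 / 2 * Real.sin (2 * Real.pi * (k : ℝ) / 5), σ]}) : EuclideanSpace ℝ (Fin 3)) = !₂[(0 : ℝ), 0, -1]) → (¬ (let d : ℝ := sInf ((fun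 z => dist z (p : EuclideanSpace ℝ (Fin 3))) '' (S \ {(p : EuclideanSpace ℝ (Fin 3))})); let T : Set (EuclideanSpace ℝ (Fin 3)) := {z : EuclideanSpace ℝ (Fin 3) | z ∈ S ∧ z ≠ (p : EuclideanSpace ℝ (Fin 3)) ∧ dist z (p : EuclideanSpace ℝ (Fin 3)) < 13 / 10 * d}; ∃ A : EuclideanSpace ℝ (Fin 3) →ₗᵢ[ℝ] EuclideanSpace ℝ (Fin 3), (∃ e : ↥T ≃ ↥Literature.Geometry.DiscreteGeometry.fccKissingPattern, ∀ t : ↥T, dist (d⁻¹ • ((t : EuclideanSpace ℝ (Fin 3)) - (p : EuclideanSpace ℝ (Fin 3)))) (A ((e t : ↥Literature.Geometry.DiscreteGeometry.fccKissingPattern) : EuclideanSpace ℝ (Fin 3))) ≤ 1 / 20) ∨ (∃ e : ↥T ≃ ↥Literature.Geometry.DiscreteGeometry.hcpKissingPattern, ∀ t : ↥T, dist (d⁻¹ • ((t : EuclideanSpace ℝ (Fin 3)) - (p : EuclideanSpace ℝ (Fin 3)))) (A ((e t : ↥Literature.Geometry.DiscreteGeometry.hcpKissingPattern) : EuclideanSpace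 ℝ (Fin 3))) ≤ 1 / 20))) ∧ ∃ A' : EuclideanSpace ℝ (Fin 3) →ₗᵢ[ℝ] EuclideanSpace ℝ (Fin 3), ∃ e' : ↥{z : EuclideanSpace ℝ (Fin 3) | z ∈ S ∧ z ≠ (p : EuclideanSpace ℝ (Fin 3)) ∧ dist z (p : EuclideanSpace ℝ (Fin 3)) < 13 / 10 * sInf ((fun z => dist z (p : EuclideanSpace ℝ (Fin 3))) '' (S \ {(p : EuclideanSpace ℝ (Fin 3))}))} ≃ ↥{p : EuclideanSpace ℝ (Fin 3) | p = !₂[(0 : ℝ), 0, 1] ∨ p = !₂[(0 : ℝ), 0, -1] ∨ ∃ k : Fin 5, ∃ σ : ℝ, (σ = 1 / 2 ∨ σ = -(1 / 2)) ∧ p = !₂[Real.sqrt 3 / 2 * Real.cos (2 * Real.pi * (k : ℝ) / 5), Real.sqrt 3 / 2 * Real.sin (2 * Real.pi * (k : ℝ) / 5), σ]}, (∀ t : ↥{z : EuclideanSpace ℝ (Fin 3) | z ∈ S ∧ z ≠ (p : EuclideanSpace ℝ (Fin 3)) ∧ dist z (p : EuclideanSpace ℝ (Fin 3)) < 13 /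 10 * sInf ((fun z => dist z (p : EuclideanSpace ℝ (Fin 3))) '' (S \ {(p : EuclideanSpace ℝ (Fin 3))}))}, dist ((sInf ((fun z => dist z (p : EuclideanSpace ℝ (Fin 3))) '' (S \ {(p : EuclideanSpace ℝ (Fin 3))})))⁻¹ • ((t : EuclideanSpace ℝ (Fin 3)) - (p : EuclideanSpace ℝ (Fin 3)))) (A' ((e' t : ↥{p : EuclideanSpace ℝ (Fin 3) | p = !₂[(0 : ℝ), 0, 1] ∨ p = !₂[(0 : ℝ), 0, -1] ∨ ∃ k : Fin 5, ∃ σ : ℝ, (σ = 1 / 2 ∨ σ = -(1 / 2)) ∧ p = !₂[Real.sqrt 3 / 2 * Real.cos (2 * Real.pi * (k : ℝ) / 5), Real.sqrt 3 / 2 * Real.sin (2 * Real.pi * (k : ℝ) / 5), σ]}) : EuclideanSpace ℝ (Fin 3))) ≤ 1 / 20) ∧ ∃ hy : y ∈ {z : EuclideanSpace ℝ (Fin 3) | z ∈ S ∧ z ≠ (p : EuclideanSpace ℝ (Fin 3)) ∧ dist z (p : EuclideanSpace ℝ (Fin 3)) < 13 / 10 * sInf ((fun z => dist z (p : EuclideanSpace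 ℝ (Fin 3))) '' (S \ {(p : EuclideanSpace ℝ (Fin 3))}))}, ((e' ⟨y, hy⟩ : ↥{p : EuclideanSpace ℝ (Fin 3) | p = !₂[(0 : ℝ), 0, 1] ∨ p = !₂[(0 : ℝ), 0, -1] ∨ ∃ k : Fin 5, ∃ σ : ℝ, (σ = 1 / 2 ∨ σ = -(1 / 2)) ∧ p = !₂[Real.sqrt 3 / 2 * Real.cos (2 * Real.pi * (k : ℝ) / 5), Real.sqrt 3 / 2 * Real.sin (2 * Real.pi * (k : ℝ) / 5), σ]}) : EuclideanSpace ℝ (Fin 3)) = -((e p : ↥{p : EuclideanSpace ℝ (Fin 3) | p = !₂[(0 : ℝ), 0, 1] ∨ p = !₂[(0 : ℝ), 0, -1] ∨ ∃ k : Fin 5, ∃ σ : ℝ, (σ = 1 / 2 ∨ σ = -(1 / 2)) ∧ p = !₂[Real.sqrt 3 / 2 * Real.cos (2 * Real.pi * (k : ℝ) / 5), Real.sqrt 3 / 2 * Real.sin (2 * Real.pi * (k : ℝ) / 5), σ]}) : EuclideanSpace ℝ (Fin 3))) → (∀ δ : ℝ, 0 < δ → ∀ S : Set (EuclideanSpace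 ℝ (Fin 3)), (∀ y ∈ S, ∀ z ∈ S, y ≠ z → δ ≤ dist y z) → (∃ R₁ : ℝ, ∀ p : EuclideanSpace ℝ (Fin 3), ∃ y ∈ S, dist y p ≤ R₁) → (∀ y ∈ S, (let d : ℝ := sInf ((fun z => dist z y) '' (S \ {y})); let T : Set (EuclideanSpace ℝ (Fin 3)) := {z : EuclideanSpace ℝ (Fin 3) | z ∈ S ∧ z ≠ y ∧ dist z y < 13 / 10 * d}; ∃ A : EuclideanSpace ℝ (Fin 3) →ₗᵢ[ℝ] EuclideanSpace ℝ (Fin 3), (∃ e : ↥T ≃ ↥Literature.Geometry.DiscreteGeometry.fccKissingPattern, ∀ t : ↥T, dist (d⁻¹ • ((t : EuclideanSpace ℝ (Fin 3)) - y)) (A ((e t : ↥Literature.Geometry.DiscreteGeometry.fccKissingPattern) : EuclideanSpace ℝ (Fin 3))) ≤ 1 / 20) ∨ (∃ e : ↥T ≃ ↥Literature.Geometry.DiscreteGeometry.hcpKissingPattern, ∀ t : ↥T, dist (d⁻¹ • ((t : EuclideanSpace ℝ (Fin 3)) - y)) (A ((e t : ↥Literature.Geometry.DiscreteGeometry.hcpKissingPattern)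 : EuclideanSpace ℝ (Fin 3))) ≤ 1 / 20) ∨ (∃ e : ↥T ≃ ↥{p : EuclideanSpace ℝ (Fin 3) | p = !₂[(0 : ℝ), 0, 1] ∨ p = !₂[(0 : ℝ), 0, -1] ∨ ∃ k : Fin 5, ∃ σ : ℝ, (σ = 1 / 2 ∨ σ = -(1 / 2)) ∧ p = !₂[Real.sqrt 3 / 2 * Real.cos (2 * Real.pi * (k : ℝ) / 5), Real.sqrt 3 / 2 * Real.sin (2 * Real.pi * (k : ℝ) / 5), σ]}, ∀ t : ↥T, dist (d⁻¹ • ((t : EuclideanSpace ℝ (Fin 3)) - y)) (A ((e t : ↥{p : EuclideanSpace ℝ (Fin 3) | p = !₂[(0 : ℝ), 0, 1] ∨ p = !₂[(0 : ℝ), 0, -1] ∨ ∃ k : Fin 5, ∃ σ : ℝ, (σ = 1 / 2 ∨ σ = -(1 / 2)) ∧ p = !₂[Real.sqrt 3 / 2 * Real.cos (2 * Real.pi * (k : ℝ) / 5), Real.sqrt 3 / 2 * Real.sin (2 * Real.pi * (k : ℝ) / 5), σ]}) : EuclideanSpace ℝ (Fin 3))) ≤ 1 / 20))) → ∃ Γ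 : Set (ℤ → EuclideanSpace ℝ (Fin 3)), (∀ y ∈ S, ¬ (let d : ℝ := sInf ((fun z => dist z y) '' (S \ {y})); let T : Set (EuclideanSpace ℝ (Fin 3)) := {z : EuclideanSpace ℝ (Fin 3) | z ∈ S ∧ z ≠ y ∧ dist z y < 13 / 10 * d}; ∃ A : EuclideanSpace ℝ (Fin 3) →ₗᵢ[ℝ] EuclideanSpace ℝ (Fin 3), (∃ e : ↥T ≃ ↥Literature.Geometry.DiscreteGeometry.fccKissingPattern, ∀ t : ↥T, dist (d⁻¹ • ((t : EuclideanSpace ℝ (Fin 3)) - y)) (A ((e t : ↥Literature.Geometry.DiscreteGeometry.fccKissingPattern) : EuclideanSpace ℝ (Fin 3))) ≤ 1 / 20) ∨ (∃ e : ↥T ≃ ↥Literature.Geometry.DiscreteGeometry.hcpKissingPattern, ∀ t : ↥T, dist (d⁻¹ • ((t : EuclideanSpace ℝ (Fin 3)) - y)) (A ((e t : ↥Literature.Geometry.DiscreteGeometry.hcpKissingPattern) : EuclideanSpace ℝ (Fin 3))) ≤ 1 / 20)) → ∃ γ ∈ Γ, ∃ n : ℤ, γ n = y) ∧ (∀ γ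 ∈ Γ, ∀ n : ℤ, γ n ∈ S ∧ ¬ (let y : EuclideanSpace ℝ (Fin 3) := γ n; let d : ℝ := sInf ((fun z => dist z y) '' (S \ {y})); let T : Set (EuclideanSpace ℝ (Fin 3)) := {z : EuclideanSpace ℝ (Fin 3) | z ∈ S ∧ z ≠ y ∧ dist z y < 13 / 10 * d}; ∃ A : EuclideanSpace ℝ (Fin 3) →ₗᵢ[ℝ] EuclideanSpace ℝ (Fin 3), (∃ e : ↥T ≃ ↥Literature.Geometry.DiscreteGeometry.fccKissingPattern, ∀ t : ↥T, dist (d⁻¹ • ((t : EuclideanSpace ℝ (Fin 3)) - y)) (A ((e t : ↥Literature.Geometry.DiscreteGeometry.fccKissingPattern) : EuclideanSpace ℝ (Fin 3))) ≤ 1 / 20) ∨ (∃ e : ↥T ≃ ↥Literature.Geometry.DiscreteGeometry.hcpKissingPattern, ∀ t : ↥T, dist (d⁻¹ • ((t : EuclideanSpace ℝ (Fin 3)) - y)) (A ((e t : ↥Literature.Geometry.DiscreteGeometry.hcpKissingPattern) : EuclideanSpace ℝ (Fin 3))) ≤ 1 / 20))) ∧ (∀ γ ∈ Γ, ∀ n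 : ℤ, (let y : EuclideanSpace ℝ (Fin 3) := γ n; let d : ℝ := sInf ((fun z => dist z y) '' (S \ {y})); let T : Set (EuclideanSpace ℝ (Fin 3)) := {z : EuclideanSpace ℝ (Fin 3) | z ∈ S ∧ z ≠ y ∧ dist z y < 13 / 10 * d}; ∃ A : EuclideanSpace ℝ (Fin 3) →ₗᵢ[ℝ] EuclideanSpace ℝ (Fin 3), (∃ e : ↥T ≃ ↥{p : EuclideanSpace ℝ (Fin 3) | p = !₂[(0 : ℝ), 0, 1] ∨ p = !₂[(0 : ℝ), 0, -1] ∨ ∃ k : Fin 5, ∃ σ : ℝ, (σ = 1 / 2 ∨ σ = -(1 / 2)) ∧ p = !₂[Real.sqrt 3 / 2 * Real.cos (2 * Real.pi * (k : ℝ) / 5), Real.sqrt 3 / 2 * Real.sin (2 * Real.pi * (k : ℝ) / 5), σ]}, ∀ t : ↥T, dist (d⁻¹ • ((t : EuclideanSpace ℝ (Fin 3)) - y)) (A ((e t : ↥{p : EuclideanSpace ℝ (Fin 3) | p = !₂[(0 : ℝ), 0, 1] ∨ p = !₂[(0 : ℝ), 0, -1] ∨ ∃ k : Fin 5, ∃ σ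 : ℝ, (σ = 1 / 2 ∨ σ = -(1 / 2)) ∧ p = !₂[Real.sqrt 3 / 2 * Real.cos (2 * Real.pi * (k : ℝ) / 5), Real.sqrt 3 / 2 * Real.sin (2 * Real.pi * (k : ℝ) / 5), σ]}) : EuclideanSpace ℝ (Fin 3))) ≤ 1 / 20) ∧ dist (d⁻¹ • (γ (n + 1) - y)) (A (!₂[(0 : ℝ), 0, 1])) ≤ 1 / 20 ∧ dist (d⁻¹ • (γ (n - 1) - y)) (A (!₂[(0 : ℝ), 0, -1])) ≤ 1 / 20))) := by
  intro hP δ hδ S hsep hdense hgood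
  refine dr5ch_columns (E := EuclideanSpace ℝ (Fin 3))
    (Rot := EuclideanSpace ℝ (Fin 3) →ₗᵢ[ℝ] EuclideanSpace ℝ (Fin 3))
    (P := ↥{p : EuclideanSpace ℝ (Fin 3) | p = !₂[(0 : ℝ), 0, 1] ∨ p = !₂[(0 : ℝ), 0, -1] ∨
      ∃ k : Fin 5, ∃ σ : ℝ, (σ = 1 / 2 ∨ σ = -(1 / 2)) ∧
        p = !₂[Real.sqrt 3 / 2 * Real.cos (2 * Real.pi * (k : ℝ) / 5),
          Real.sqrt 3 / 2 * Real.sin (2 * Real.pi * (k : ℝ) / 5), σ]})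
    (S := S)
    (GF := fun y =>
      let d : ℝ := sInf ((fun z => dist z y) '' (S \ {y}))
      let T : Set (EuclideanSpace ℝ (Fin 3)) :=
        {z : EuclideanSpace ℝ (Fin 3) | z ∈ S ∧ z ≠ y ∧ dist z y < 13 / 10 * d}
      ∃ A : EuclideanSpace ℝ (Fin 3) →ₗᵢ[ℝ] EuclideanSpace ℝ (Fin 3),
        (∃ e : ↥T ≃ ↥Literature.Geometry.DiscreteGeometry.fccKissingPattern, ∀ t : ↥T,
          dist (d⁻¹ • ((t : EuclideanSpace ℝ (Fin 3)) - y))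
            (A ((e t : ↥Literature.Geometry.DiscreteGeometry.fccKissingPattern) :
              EuclideanSpace ℝ (Fin 3))) ≤ 1 / 20) ∨
        (∃ e : ↥T ≃ ↥Literature.Geometry.DiscreteGeometry.hcpKissingPattern, ∀ t : ↥T,
          dist (d⁻¹ • ((t : EuclideanSpace ℝ (Fin 3)) - y))
            (A ((e t : ↥Literature.Geometry.DiscreteGeometry.hcpKissingPattern) :
              EuclideanSpace ℝ (Fin 3))) ≤ 1 / 20))
    (T := fun y =>
      {z : EuclideanSpace ℝ (Fin 3) | z ∈ S ∧ z ≠ y ∧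
        dist z y < 13 / 10 * sInf ((fun z => dist z y) '' (S \ {y}))})
    (tol := fun y A e =>
      ∀ t : ↥{z : EuclideanSpace ℝ (Fin 3) | z ∈ S ∧ z ≠ y ∧
          dist z y < 13 / 10 * sInf ((fun z => dist z y) '' (S \ {y}))},
        dist ((sInf ((fun z => dist z y) '' (S \ {y})))⁻¹ • ((t : EuclideanSpace ℝ (Fin 3)) - y))
          (A ((e t : ↥{p : EuclideanSpace ℝ (Fin 3) | p = !₂[(0 : ℝ), 0, 1] ∨
            p = !₂[(0 : ℝ), 0, -1] ∨ ∃ k : Fin 5, ∃ σ : ℝ, (σ = 1 / 2 ∨ σ = -(1 / 2)) ∧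
              p = !₂[Real.sqrt 3 / 2 * Real.cos (2 * Real.pi * (k : ℝ) / 5),
                Real.sqrt 3 / 2 * Real.sin (2 * Real.pi * (k : ℝ) / 5), σ]}) :
            EuclideanSpace ℝ (Fin 3))) ≤ 1 / 20)
    (pN := ⟨!₂[(0 : ℝ), 0, 1], Or.inl rfl⟩) (pS := ⟨!₂[(0 : ℝ), 0, -1], Or.inr (Or.inl rfl)⟩)
    (Qn := fun y A z =>
      dist ((sInf ((fun z => dist z y) '' (S \ {y})))⁻¹ • (z - y)) (A (!₂[(0 : ℝ), 0, 1])) ≤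
        1 / 20)
    (Qs := fun y A z =>
      dist ((sInf ((fun z => dist z y) '' (S \ {y})))⁻¹ • (z - y)) (A (!₂[(0 : ℝ), 0, -1])) ≤
        1 / 20)
    (fun y t => t.2.1) ?_ ?_ ?_ ?_ ?_
  · -- north-pole tolerance, read off from the matching
    intro y A e he
    have h1 := he (e.symm ⟨!₂[(0 : ℝ), 0, 1], Or.inl rfl⟩)
    rw [Equiv.apply_symm_apply] at h1
    exact h1
  · -- south-pole tolerance
    intro y A e he
    have h1 := he (e.symm ⟨!₂[(0 : ℝ), 0, -1], Or.inr (Or.inl rfl)⟩)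
    rw [Equiv.apply_symm_apply] at h1
    exact h1
  · -- POLE at a north pole
    intro y hy A e he p hp
    obtain ⟨h1, A', e', he', hy', h2⟩ :=
      hP δ hδ S hsep hdense hgood y hy A e he p (Or.inl (by rw [hp]))
    exact ⟨h1, A', e', he', hy', Subtype.ext (h2.trans (by rw [hp]; exact dr5ch_neg_north))⟩
  · -- POLE at a south pole
    intro y hy A e he p hp
    obtain ⟨h1, A', e', he', hy', h2⟩ :=
      hP δ hδ S hsep hdense hgood y hy A e he p (Or.inr (by rw [hp]))
    exact ⟨h1, A', e', he', hy', Subtype.ext (h2.trans (by rw [hp]; exact dr5ch_neg_south))⟩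
  · -- an axis site is deca-matched
    intro y hy hng
    obtain ⟨A, hA⟩ := hgood y hy
    rcases hA with ⟨e, he⟩ | ⟨e, he⟩ | ⟨e, he⟩
    · exact (hng ⟨A, Or.inl ⟨e, he⟩⟩).elim
    · exact (hng ⟨A, Or.inr ⟨e, he⟩⟩).elim
    · exact ⟨A, e, he⟩

/-- **Chains of poles** (registered stub `stub_dr5_chains` of crux `FiveFoldRation`, line `Sketch`):
the pole lemma implies the column family `Γ` with (c1)–(c3). Same proposition as
`stub_dr5_chains_verbatim`, with the crux's inline predicates (decahedral pattern `Dc`, nearest-neighbour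
distance `nd`, first shell `Sh`, fcc/hcp matchings `F`/`H`, decahedral tolerance `Tol`) bound by `let`;
the two statements are definitionally equal (`exact`). -/
theorem stub_dr5_chains : (let Dc := {p : EuclideanSpace ℝ (Fin 3) | p = !₂[(0 : ℝ), 0, 1] ∨ p = !₂[(0 : ℝ), 0, -1] ∨ ∃ k : Fin 5, ∃ σ : ℝ, (σ = 1 / 2 ∨ σ = -(1 / 2)) ∧ p = !₂[Real.sqrt 3 / 2 * Real.cos (2 * Real.pi * (k : ℝ) / 5), Real.sqrt 3 / 2 * Real.sin (2 * Real.pi * (k : ℝ) / 5), σ]}; let nd := fun (S : Set (EuclideanSpace ℝ (Fin 3))) (y : EuclideanSpace ℝ (Fin 3)) => sInf ((fun z => dist z y) '' (S \ {y})); let Sh := fun (S : Set (EuclideanSpace ℝ (Fin 3))) (y : EuclideanSpace ℝ (Fin 3)) => {z : EuclideanSpace ℝ (Fin 3) | z ∈ S ∧ z ≠ y ∧ dist z y < 13 / 10 * nd S y}; let F := fun (S : Set (EuclideanSpace ℝ (Fin 3))) (y : EuclideanSpace ℝ (Fin 3)) (A : EuclideanSpace ℝ (Fin 3) →ₗᵢ[ℝ]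 EuclideanSpace ℝ (Fin 3)) => ∃ e : ↥(Sh S y) ≃ ↥Literature.Geometry.DiscreteGeometry.fccKissingPattern, ∀ t : ↥(Sh S y), dist ((nd S y)⁻¹ • (t.1 - y)) (A (e t).1) ≤ 1 / 20; let H := fun (S : Set (EuclideanSpace ℝ (Fin 3))) (y : EuclideanSpace ℝ (Fin 3)) (A : EuclideanSpace ℝ (Fin 3) →ₗᵢ[ℝ] EuclideanSpace ℝ (Fin 3)) => ∃ e : ↥(Sh S y) ≃ ↥Literature.Geometry.DiscreteGeometry.hcpKissingPattern, ∀ t : ↥(Sh S y), dist ((nd S y)⁻¹ • (t.1 - y)) (A (e t).1) ≤ 1 / 20; let Tol := fun (S : Set (EuclideanSpace ℝ (Fin 3))) (y : EuclideanSpace ℝ (Fin 3)) (A : EuclideanSpace ℝ (Fin 3) →ₗᵢ[ℝ] EuclideanSpace ℝ (Fin 3)) (e : ↥(Sh S y) ≃ ↥Dc) => ∀ t : ↥(Sh S y), dist ((nd S y)⁻¹ • (t.1 - y)) (A (e t).1) ≤ 1 / 20; (∀ δ : ℝ, 0 < δ → ∀ S : Set (EuclideanSpace ℝ (Fin 3)),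 (∀ y ∈ S, ∀ z ∈ S, y ≠ z → δ ≤ dist y z) → (∃ R₁ : ℝ, ∀ p : EuclideanSpace ℝ (Fin 3), ∃ y ∈ S, dist y p ≤ R₁) → (∀ y ∈ S, ∃ A : EuclideanSpace ℝ (Fin 3) →ₗᵢ[ℝ] EuclideanSpace ℝ (Fin 3), F S y A ∨ H S y A ∨ ∃ e : ↥(Sh S y) ≃ ↥Dc, Tol S y A e) → ∀ y ∈ S, ∀ A : EuclideanSpace ℝ (Fin 3) →ₗᵢ[ℝ] EuclideanSpace ℝ (Fin 3), ∀ e : ↥(Sh S y) ≃ ↥Dc, Tol S y A e → ∀ p : ↥(Sh S y), ((e p).1 = !₂[(0 : ℝ), 0, 1] ∨ (e p).1 = !₂[(0 : ℝ), 0, -1]) → (¬ ∃ A : EuclideanSpace ℝ (Fin 3) →ₗᵢ[ℝ] EuclideanSpace ℝ (Fin 3), F S p.1 A ∨ H S p.1 A) ∧ ∃ A' : EuclideanSpace ℝ (Fin 3) →ₗᵢ[ℝ] EuclideanSpace ℝ (Fin 3), ∃ e' : ↥(Sh S p.1) ≃ ↥Dc, Tol S p.1 A' e' ∧ ∃ hy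 : y ∈ Sh S p.1, (e' ⟨y, hy⟩).1 = -(e p).1) → (∀ δ : ℝ, 0 < δ → ∀ S : Set (EuclideanSpace ℝ (Fin 3)), (∀ y ∈ S, ∀ z ∈ S, y ≠ z → δ ≤ dist y z) → (∃ R₁ : ℝ, ∀ p : EuclideanSpace ℝ (Fin 3), ∃ y ∈ S, dist y p ≤ R₁) → (∀ y ∈ S, ∃ A : EuclideanSpace ℝ (Fin 3) →ₗᵢ[ℝ] EuclideanSpace ℝ (Fin 3), F S y A ∨ H S y A ∨ ∃ e : ↥(Sh S y) ≃ ↥Dc, Tol S y A e) → ∃ Γ : Set (ℤ → EuclideanSpace ℝ (Fin 3)), (∀ y ∈ S, ¬ (∃ A : EuclideanSpace ℝ (Fin 3) →ₗᵢ[ℝ] EuclideanSpace ℝ (Fin 3), F S y A ∨ H S y A) → ∃ γ ∈ Γ, ∃ n : ℤ, γ n = y) ∧ (∀ γ ∈ Γ, ∀ n : ℤ, γ n ∈ S ∧ ¬ (∃ A : EuclideanSpace ℝ (Fin 3) →ₗᵢ[ℝ] EuclideanSpace ℝ (Fin 3), F S (γ n) A ∨ H S (γ n) A)) ∧ (∀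 γ ∈ Γ, ∀ n : ℤ, ∃ A : EuclideanSpace ℝ (Fin 3) →ₗᵢ[ℝ] EuclideanSpace ℝ (Fin 3), (∃ e : ↥(Sh S (γ n)) ≃ ↥Dc, Tol S (γ n) A e) ∧ dist ((nd S (γ n))⁻¹ • (γ (n + 1) - γ n)) (A (!₂[(0 : ℝ), 0, 1])) ≤ 1 / 20 ∧ dist ((nd S (γ n))⁻¹ • (γ (n - 1) - γ n)) (A (!₂[(0 : ℝ), 0, -1])) ≤ 1 / 20))) := by
  exact stub_dr5_chains_verbatim

end Summit.AtomisticToContinuum.Crystallization.Theorems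

end
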